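import Summits.ResolutionOfSingularities.ResolutionOfSingularities.Theorems.WildQuotientsSummitReductionStubPairRegularBaseChangePullback
import HarnessLib

/-!
# `WildQuotients.SummitReduction` (stmt-ResolutionOfSingularities-16324), line `FramePerfect`:
# the Galois link of the pulled-back family for stub `stub_pair_regularBaseChange` (de Jong 1997, 5.4 with (5.4.1))

Route `ResolutionOfSingularities/WildQuotients`, crux `SummitReduction`; third helper file of stub
`stub_pair_regularBaseChange` of the line skeleton `Cruxes/SummitReduction/Lines/FramePerfect.lean`
(v6). De Jong 1997, 5.4: "Suppose that `X → S` has a geometrically irreducible generic fibre. In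
this case (5.4.1) implies that the map `X' → (X ×_S S')~` is a Galois alteration (both with group
`G'`)." Here, for the pull-back step of the pair induction, `X' = X ×_S S'` itself
(`P = X₁ ×_{Y₁} Y₂`, integral), the group is the fibre product
`G' = {(g₂, g₁) | ρ₂(g₂) ≫ ψ₂ = ψ₂ ≫ ρ_{Y₁}(g₁)} ⊆ G₂ × G₁` acting factorwise, and (5.4.1) holds
because `Y₁` is separated (an automorphism of `Y₂` over `K(Y₁)` is over `Y₁`). PROVED here,
hypothesis-free:

* `galois_clause_pullback` — the purely inseparable clause `K(X)^G ⊂ K(P)^{G'}` along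
  `P → X₁ → X`, for any finite group `G'` acting on `P` compatibly with homomorphisms
  `pr₂ : G' ↠ G₁` (on `X₁`) and `pr₁ : G' → G₂` (on `Y₂`) and satisfying the kernel condition
  (5.4.1), granted that `K(P)` is the compositum of `K(X₁)` and `K(Y₂)`; assembled from
  `fixedPoints_le_sup_inf_fixedPoints`, `pow_expChar_pow_mem_of_smul_eq_of_kernel` and
  `eq_of_functionFieldMap_eq` of the first helper file;
* `pullbackSection_comp_eq` — the pulled-back sections are permuted by any endomorphism of `P`
  covering compatible automorphisms of `X₁`, `Y₂`, `Y₁`;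
* `ratFn_functionFieldMap_congr`, `ratFn_functionFieldMap_comp_apply` — bookkeeping for `♯`.
-/

set_option linter.dupNamespace false

noncomputable section

open CategoryTheory CategoryTheory.Limits AlgebraicGeometry TopologicalSpace
open Literature.AlgebraicGeometry.Resolution
open Literature.AlgebraicGeometry.Motives (RatFn.functionFieldMap RatFn.functionFieldMap_comp)
open Literature.AlgebraicGeometry

namespace Summit.ResolutionOfSingularities.ResolutionOfSingularities.Theorems

/-! ## The purely inseparable clause of the pulled-back family (de Jong 1997, 5.4) -/

section GaloisPullback

universe v

/-- Rewriting the morphism inside `functionFieldMap`. [folklore] -/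
theorem ratFn_functionFieldMap_congr {X' X : Scheme.{v}} [IsIntegral X'] [IsIntegral X] {α β : X' ⟶ X}
    [IsDominant α] [IsDominant β] (h : α = β) :
    RatFn.functionFieldMap α = RatFn.functionFieldMap β := by
  subst h
  rfl

/-- `(α ≫ β)♯ a = α♯ (β♯ a)` on function fields. [folklore] -/
theorem ratFn_functionFieldMap_comp_apply {X'' X' X : Scheme.{v}} [IsIntegral X''] [IsIntegral X']
    [IsIntegral X] (β : X' ⟶ X) [IsDominant β] (α : X'' ⟶ X') [IsDominant α]
    (a : X.functionField) :
    RatFn.functionFieldMap (α ≫ β) a = RatFn.functionFieldMap α (RatFn.functionFieldMap β a) := by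
  rw [RatFn.functionFieldMap_comp β α, RingHom.comp_apply]

/-- **de Jong 1997, 5.4: "(5.4.1) implies that `X' → (X ×_S S')~` is a Galois alteration"** — the
purely inseparable clause for the pulled-back family, in the shape of the pair induction. Data: a
`φ₁`-equivariant dominant `π₁ : X₁ → X` with `K(X)^G ⊂ K(X₁)^{G₁}` purely inseparable (`hgal`), a
`G₁`-equivariant dominant `f₁ : X₁ → Y₁`, a `φ₂`-equivariant dominant `ψ₂ : Y₂ → Y₁` with
`K(Y₁)^{G₁} ⊂ K(Y₂)^{G₂}` purely inseparable (`hgal₂`), `Y₁` separated, the fibre product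
`P = X₁ ×_{Y₁} Y₂` integral with dominant projections whose function field is generated by
`K(X₁)` and `K(Y₂)` (`hgen`), and a finite group `G'` acting on `P` compatibly with `pr₂ : G' → G₁`
on `X₁` and `pr₁ : G' → G₂` on `Y₂`, such that `pr₂` is onto and — condition (5.4.1) — every
`g₂ ∈ G₂` acting on `Y₂` over `Y₁` lifts to some `g ∈ G'` with `pr₂ g = 1`. Then
`K(X)^G ⊂ K(P)^{G'}` is purely inseparable along `P → X₁ → X`. Proof: for a `G'`-invariant `a`, the
subgroup `N = Ker pr₂` acts on `K(P)` through a finite group `Γ` of automorphisms fixing `K(X₁)`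
and stabilising `K(Y₂)`, so `a ∈ K(X₁) ∨ (K(Y₂) ∩ K(P)^Γ)` (`fixedPoints_le_sup_inf_fixedPoints`); an
element `b ∈ K(Y₂)` whose image is `Γ`-invariant is fixed by every `g₂` acting trivially on
`K(Y₁)` — such `g₂` act on `Y₂` over `Y₁` (`eq_of_functionFieldMap_eq`) and lift into `N` by
(5.4.1) — hence `b ^ qⁿ ∈ K(Y₁)` (`pow_expChar_pow_mem_of_smul_eq_of_kernel` with `hgal₂`), whose
image lies in `K(X₁)`; so `a ^ qⁿ ∈ K(X₁)`, `G₁`-invariant as `pr₂` is onto, and `hgal` concludes.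
[cite: DeJong1997, 5.4, p. 613] -/
theorem galois_clause_pullback {X : Scheme.{v}} [IsIntegral X] {G : Type*} [Group G]
    (ρ : G →* Aut X) {X₁ Y₁ Y₂ : Scheme.{v}} [IsIntegral X₁] [IsIntegral Y₁] [IsIntegral Y₂]
    [Y₁.IsSeparated] (f₁ : X₁ ⟶ Y₁) [IsDominant f₁] {G₁ : Type*} [Group G₁]
    (ρX₁ : G₁ →* Aut X₁) (ρY₁ : G₁ →* Aut Y₁)
    (π₁ : X₁ ⟶ X) [IsDominant π₁]
    (hgal : ∀ a : X₁.functionField, (∀ g : G₁, RatFn.functionFieldMap (ρX₁ g).hom a = a) →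
        ∃ (n : ℕ) (c : X.functionField), (∀ g : G, RatFn.functionFieldMap (ρ g).hom c = c) ∧
          a ^ ringExpChar X.functionField ^ n = RatFn.functionFieldMap π₁ c)
    {G₂ : Type*} [Group G₂] [Finite G₂] (ρ₂ : G₂ →* Aut Y₂) (φ₂ : G₂ →* G₁)
    (ψ₂ : Y₂ ⟶ Y₁) [IsDominant ψ₂]
    (hψ₂G : ∀ g : G₂, (ρ₂ g).hom ≫ ψ₂ = ψ₂ ≫ (ρY₁ (φ₂ g)).hom)
    (hgal₂ : ∀ a : Y₂.functionField, (∀ g : G₂, RatFn.functionFieldMap (ρ₂ g).hom a = a) →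
        ∃ (n : ℕ) (c : Y₁.functionField), (∀ g : G₁, RatFn.functionFieldMap (ρY₁ g).hom c = c) ∧
          a ^ ringExpChar Y₁.functionField ^ n = RatFn.functionFieldMap ψ₂ c)
    [IsIntegral (pullback f₁ ψ₂)] [IsDominant (pullback.fst f₁ ψ₂)]
    [IsDominant (pullback.snd f₁ ψ₂)]
    (hgen : (RatFn.functionFieldMap (pullback.fst f₁ ψ₂)).fieldRange ⊔
        (RatFn.functionFieldMap (pullback.snd f₁ ψ₂)).fieldRange = ⊤)
    {G' : Type*} [Group G'] [Finite G'] (pr₁ : G' →* G₂) (pr₂ : G' →* G₁)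
    (ρP : G' →* Aut (pullback f₁ ψ₂))
    (hρP₁ : ∀ g : G', (ρP g).hom ≫ pullback.fst f₁ ψ₂ = pullback.fst f₁ ψ₂ ≫ (ρX₁ (pr₂ g)).hom)
    (hρP₂ : ∀ g : G', (ρP g).hom ≫ pullback.snd f₁ ψ₂ = pullback.snd f₁ ψ₂ ≫ (ρ₂ (pr₁ g)).hom)
    (hlift : Function.Surjective pr₂)
    (hker : ∀ g₂ : G₂, (ρ₂ g₂).hom ≫ ψ₂ = ψ₂ → ∃ g : G', pr₁ g = g₂ ∧ pr₂ g = 1)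
    (a : (pullback f₁ ψ₂).functionField) (ha : ∀ g : G', RatFn.functionFieldMap (ρP g).hom a = a) :
    ∃ (n : ℕ) (c : X.functionField), (∀ g : G, RatFn.functionFieldMap (ρ g).hom c = c) ∧
      a ^ ringExpChar X.functionField ^ n = RatFn.functionFieldMap (pullback.fst f₁ ψ₂ ≫ π₁) c := by
  classical
  let fst := pullback.fst f₁ ψ₂
  let snd := pullback.snd f₁ ψ₂
  let M := (pullback f₁ ψ₂).functionField
  -- exponential characteristics agree along the (injective) field maps
  obtain ⟨q, hq⟩ := ExpChar.exists X.functionField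
  haveI : ExpChar X₁.functionField q :=
    expChar_of_injective_ringHom (RatFn.functionFieldMap π₁).injective q
  haveI : ExpChar M q := expChar_of_injective_ringHom (RatFn.functionFieldMap fst).injective q
  haveI : ExpChar Y₂.functionField q := RingHom.expChar _ (RatFn.functionFieldMap snd).injective q
  haveI : ExpChar Y₁.functionField q := RingHom.expChar _ (RatFn.functionFieldMap ψ₂).injective q
  have hqX : ringExpChar X.functionField = q := ringExpChar.eq _ q
  have hqY₁ : ringExpChar Y₁.functionField = q := ringExpChar.eq _ q
  -- the actions on function fields (through the opposite groups: `♯` is contravariant)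
  letI actP : MulSemiringAction G'ᵐᵒᵖ M :=
    { smul := fun g x => RatFn.functionFieldMap (ρP g.unop).hom x
      one_smul := fun x => by
        show RatFn.functionFieldMap (ρP 1).hom x = x
        rw [ratFn_functionFieldMap_congr (by rw [map_one]; rfl : (ρP 1).hom = 𝟙 _),
          Motives.RatFn.functionFieldMap_id]
        rfl
      mul_smul := fun g h x => by
        show RatFn.functionFieldMap (ρP (h.unop * g.unop)).hom x =
          RatFn.functionFieldMap (ρP g.unop).hom (RatFn.functionFieldMap (ρP h.unop).hom x)
        rw [ratFn_functionFieldMap_congr (by rw [map_mul]; rfl :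
          (ρP (h.unop * g.unop)).hom = (ρP g.unop).hom ≫ (ρP h.unop).hom),
          ratFn_functionFieldMap_comp_apply]
      smul_zero := fun g => map_zero _
      smul_add := fun g x y => map_add _ x y
      smul_one := fun g => map_one _
      smul_mul := fun g x y => map_mul _ x y }
  have smulP : ∀ (g : G'ᵐᵒᵖ) (x : M), g • x = RatFn.functionFieldMap (ρP g.unop).hom x :=
    fun _ _ => rfl
  letI act₂ : MulSemiringAction G₂ᵐᵒᵖ Y₂.functionField :=
    { smul := fun g x => RatFn.functionFieldMap (ρ₂ g.unop).hom x
      one_smul := fun x => by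
        show RatFn.functionFieldMap (ρ₂ 1).hom x = x
        rw [ratFn_functionFieldMap_congr (by rw [map_one]; rfl : (ρ₂ 1).hom = 𝟙 _),
          Motives.RatFn.functionFieldMap_id]
        rfl
      mul_smul := fun g h x => by
        show RatFn.functionFieldMap (ρ₂ (h.unop * g.unop)).hom x =
          RatFn.functionFieldMap (ρ₂ g.unop).hom (RatFn.functionFieldMap (ρ₂ h.unop).hom x)
        rw [ratFn_functionFieldMap_congr (by rw [map_mul]; rfl :
          (ρ₂ (h.unop * g.unop)).hom = (ρ₂ g.unop).hom ≫ (ρ₂ h.unop).hom),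
          ratFn_functionFieldMap_comp_apply]
      smul_zero := fun g => map_zero _
      smul_add := fun g x y => map_add _ x y
      smul_one := fun g => map_one _
      smul_mul := fun g x y => map_mul _ x y }
  have smul₂ : ∀ (g : G₂ᵐᵒᵖ) (x : Y₂.functionField),
      g • x = RatFn.functionFieldMap (ρ₂ g.unop).hom x := fun _ _ => rfl
  haveI : Finite G'ᵐᵒᵖ := Finite.of_equiv G' MulOpposite.opEquiv
  haveI : Finite G₂ᵐᵒᵖ := Finite.of_equiv G₂ MulOpposite.opEquiv
  -- equivariance of `fst♯`, `snd♯`, `ψ₂♯`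
  have hfstG : ∀ (g : G') (y : X₁.functionField), RatFn.functionFieldMap (ρP g).hom
      (RatFn.functionFieldMap fst y) = RatFn.functionFieldMap fst
        (RatFn.functionFieldMap (ρX₁ (pr₂ g)).hom y) := fun g y => by
    rw [← ratFn_functionFieldMap_comp_apply, ratFn_functionFieldMap_congr (hρP₁ g), ratFn_functionFieldMap_comp_apply]
  have hsndG : ∀ (g : G') (y : Y₂.functionField), RatFn.functionFieldMap (ρP g).hom
      (RatFn.functionFieldMap snd y) = RatFn.functionFieldMap snd
        (RatFn.functionFieldMap (ρ₂ (pr₁ g)).hom y) := fun g y => by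
    rw [← ratFn_functionFieldMap_comp_apply, ratFn_functionFieldMap_congr (hρP₂ g), ratFn_functionFieldMap_comp_apply]
  have hψG : ∀ (g : G₂) (c : Y₁.functionField), RatFn.functionFieldMap (ρ₂ g).hom
      (RatFn.functionFieldMap ψ₂ c) = RatFn.functionFieldMap ψ₂
        (RatFn.functionFieldMap (ρY₁ (φ₂ g)).hom c) := fun g c => by
    rw [← ratFn_functionFieldMap_comp_apply, ratFn_functionFieldMap_congr (hψ₂G g), ratFn_functionFieldMap_comp_apply]
  -- the kernel `N = Ker pr₂` and the finite group `Γ` of automorphisms of `M` it induces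
  let N : Subgroup G'ᵐᵒᵖ := pr₂.ker.op
  let Γ : Subgroup (M ≃+* M) := (MulSemiringAction.toRingEquiv N M).range
  haveI : Finite Γ := Finite.of_surjective _ (MulSemiringAction.toRingEquiv N M).rangeRestrict_surjective
  have hΓ : ∀ σ ∈ Γ, ∃ g : G', pr₂ g = 1 ∧ ∀ x : M, σ x = RatFn.functionFieldMap (ρP g).hom x := by
    rintro σ ⟨n, rfl⟩
    refine ⟨n.1.unop, n.2, fun x => ?_⟩
    rw [MulSemiringAction.toRingEquiv_apply_apply]
    rfl
  have hΓ' : ∀ g : G', pr₂ g = 1 → ∃ σ ∈ Γ, ∀ x : M, σ x = RatFn.functionFieldMap (ρP g).hom x := by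
    intro g hg
    refine ⟨MulSemiringAction.toRingEquiv N M ⟨MulOpposite.op g, hg⟩, ⟨_, rfl⟩, fun x => ?_⟩
    rw [MulSemiringAction.toRingEquiv_apply_apply]
    rfl
  let L : Subfield M := (RatFn.functionFieldMap fst).fieldRange
  let Es : Subfield M := (RatFn.functionFieldMap snd).fieldRange
  have hL : ∀ σ ∈ Γ, ∀ x ∈ L, σ x = x := by
    rintro σ hσ _ ⟨y, rfl⟩
    obtain ⟨g, hg, hσ⟩ := hΓ σ hσ
    rw [hσ, hfstG, hg, ratFn_functionFieldMap_congr (by rw [map_one]; rfl : (ρX₁ 1).hom = 𝟙 _),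
      Motives.RatFn.functionFieldMap_id]
    rfl
  have hE : ∀ σ ∈ Γ, ∀ x ∈ Es, σ x ∈ Es := by
    rintro σ hσ _ ⟨y, rfl⟩
    obtain ⟨g, -, hσ⟩ := hΓ σ hσ
    rw [hσ, hsndG]
    exact ⟨_, rfl⟩
  -- `a` is `Γ`-invariant, hence in `L ∨ (Es ∩ M^Γ)`
  have haΓ : a ∈ FixedPoints.subfield Γ M := by
    intro σ
    obtain ⟨g, -, hσ⟩ := hΓ σ.1 σ.2
    show σ.1 a = a
    rw [hσ, ha]
  have hmem : a ∈ L ⊔ (Es ⊓ FixedPoints.subfield Γ M) :=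
    fixedPoints_le_sup_inf_fixedPoints Γ L Es hL hE hgen haΓ
  -- every element of `Es ∩ M^Γ` has a `q`-power-power in `L`
  haveI : ExpChar L q := RingHom.expChar L.subtype Subtype.coe_injective q
  let K : Subfield Y₂.functionField := (RatFn.functionFieldMap ψ₂).fieldRange
  haveI : IsInvariantSubfield G₂ᵐᵒᵖ K := ⟨by
    rintro g _ ⟨c, rfl⟩
    rw [smul₂, hψG]
    exact ⟨_, rfl⟩⟩
  have hd : ∀ b : Y₂.functionField, (∀ g : G₂ᵐᵒᵖ, g • b = b) → ∃ n : ℕ, b ^ q ^ n ∈ K := by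
    intro b hb
    obtain ⟨n, c, -, hc⟩ := hgal₂ b fun g => hb (MulOpposite.op g)
    rw [hqY₁] at hc
    exact ⟨n, ⟨c, hc.symm⟩⟩
  have hE₀ : ∀ e ∈ Es ⊓ FixedPoints.subfield Γ M, e ∈ perfectClosure L M := by
    rintro e ⟨⟨b, rfl⟩, heΓ⟩
    -- `b` is fixed by every `g₂` acting trivially on `K(Y₁)`: such `g₂` act over `Y₁`, so lift into `N`
    have hb : ∀ g : G₂ᵐᵒᵖ, (∀ x ∈ K, g • x = x) → g • b = b := by
      intro g hg
      have hψ : (ρ₂ g.unop).hom ≫ ψ₂ = ψ₂ := by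
        refine eq_of_functionFieldMap_eq _ _ (RingHom.ext fun c => ?_)
        rw [ratFn_functionFieldMap_comp_apply]
        exact hg _ ⟨c, rfl⟩
      obtain ⟨g', hg'₁, hg'₂⟩ := hker g.unop hψ
      obtain ⟨σ, hσΓ, hσ⟩ := hΓ' g' hg'₂
      have h1 : σ (RatFn.functionFieldMap snd b) = RatFn.functionFieldMap snd b := heΓ ⟨σ, hσΓ⟩
      rw [hσ, hsndG, hg'₁] at h1
      exact (RatFn.functionFieldMap snd).injective h1
    obtain ⟨n, ⟨c, hc⟩⟩ := pow_expChar_pow_mem_of_smul_eq_of_kernel G₂ᵐᵒᵖ q K hd hb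
    rw [mem_perfectClosure_iff_pow_mem q]
    refine ⟨n, ⟨⟨RatFn.functionFieldMap fst (RatFn.functionFieldMap f₁ c), ⟨_, rfl⟩⟩, ?_⟩⟩
    show RatFn.functionFieldMap fst (RatFn.functionFieldMap f₁ c) = (RatFn.functionFieldMap snd b) ^ q ^ n
    rw [← map_pow, ← hc, ← ratFn_functionFieldMap_comp_apply, ← ratFn_functionFieldMap_comp_apply,
      ratFn_functionFieldMap_congr pullback.condition]
  have hle : L ⊔ (Es ⊓ FixedPoints.subfield Γ M) ≤ (perfectClosure L M).toSubfield := by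
    refine sup_le (fun x hx => ?_) hE₀
    show x ∈ perfectClosure L M
    rw [mem_perfectClosure_iff_pow_mem q]
    exact ⟨0, ⟨⟨x, hx⟩, by rw [pow_zero, pow_one]; rfl⟩⟩
  have haP : a ∈ perfectClosure L M := hle hmem
  rw [mem_perfectClosure_iff_pow_mem q] at haP
  obtain ⟨n, ⟨⟨_, ⟨a₁, rfl⟩⟩, ha₁⟩⟩ := haP
  change RatFn.functionFieldMap fst a₁ = a ^ q ^ n at ha₁
  -- `a₁` is `G₁`-invariant since `pr₂` is onto
  have ha₁G : ∀ g₁ : G₁, RatFn.functionFieldMap (ρX₁ g₁).hom a₁ = a₁ := by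
    intro g₁
    obtain ⟨g, rfl⟩ := hlift g₁
    apply (RatFn.functionFieldMap fst).injective
    rw [← hfstG, ha₁, map_pow, ha]
  obtain ⟨m, c, hcG, hc⟩ := hgal a₁ ha₁G
  refine ⟨n + m, c, hcG, ?_⟩
  rw [hqX] at hc ⊢
  rw [ratFn_functionFieldMap_comp_apply, ← hc, map_pow, ha₁, ← pow_mul, ← pow_add]

end GaloisPullback

/-! ## Equivariance of the pulled-back sections -/

section Sections

universe w

/-- **The pulled-back sections are permuted like the original ones**: if an endomorphism `θ` of
`X ×_Y Y'` covers `a` on `X` and `b` on `Y'`, `b` covers `c` on `Y` along `ψ`, and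
`σᵢ ≫ a = c ≫ σⱼ`, then `τᵢ ≫ θ = b ≫ τⱼ` for the pulled-back sections `τ` (check on the two
projections). [folklore] -/
theorem pullbackSection_comp_eq {X Y Y' : Scheme.{w}} {f : X ⟶ Y} {n : ℕ} {σ : Fin n → (Y ⟶ X)}
    (hσ : ∀ i, σ i ≫ f = 𝟙 Y) (ψ : Y' ⟶ Y) {θ : pullback f ψ ⟶ pullback f ψ} {a : X ⟶ X}
    {b : Y' ⟶ Y'} {c : Y ⟶ Y} (hθ₁ : θ ≫ pullback.fst f ψ = pullback.fst f ψ ≫ a)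
    (hθ₂ : θ ≫ pullback.snd f ψ = pullback.snd f ψ ≫ b) (hbc : b ≫ ψ = ψ ≫ c) {i j : Fin n}
    (hij : σ i ≫ a = c ≫ σ j) :
    DeJong1996.PreSemiStablePair.pullbackSection hσ ψ i ≫ θ =
      b ≫ DeJong1996.PreSemiStablePair.pullbackSection hσ ψ j := by
  apply pullback.hom_ext
  · simp only [Category.assoc, DeJong1996.PreSemiStablePair.pullbackSection_fst]
    rw [hθ₁, ← Category.assoc, DeJong1996.PreSemiStablePair.pullbackSection_fst, Category.assoc, hij,
      reassoc_of% hbc]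
  · simp only [Category.assoc, DeJong1996.PreSemiStablePair.pullbackSection_snd, Category.comp_id]
    rw [hθ₂, ← Category.assoc, DeJong1996.PreSemiStablePair.pullbackSection_snd, Category.id_comp]

end Sections

end Summit.ResolutionOfSingularities.ResolutionOfSingularities.Theorems

end
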